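import Literature.Probability.RandomPlanarGeometry.HexSAWBrickWallStripFugacityWidthOneContactEntropyDuality
import HarnessLib

/-!
# The weak two-dimensional LDP of the contact-density pair: open-set lower bound, compact-convex upper bound

Child module of the joint contact LDP chain (`…JointContactLDP` §2/§10, `…ContactEntropyDuality` §3).  With the density-coordinate
rate `J̃_{y,z}(a,a') := J(y,z; Y(a,a'), Y(a',a))` (`jointRate` at the inverse equation of state `eosY`) on the open density triangle `T`:
* §1 continuity of `J̃_{y,z}` on `T`;
* §2 ★★★ LOWER BOUND ON OPEN SETS: for `G` open and `p ∈ G ∩ T`, `P_{N,y,z}((bc/N, tc/N) ∈ G) ≥ e^{−N(J̃(p)+ε)}` eventually;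
* §3 ★★★ UPPER BOUND ON COMPACT CONVEX SETS: for `K ⊆ T` nonempty compact convex there is `m ∈ K` minimising `J̃` on `K` with
  `P_{N,y,z}((bc/N, tc/N) ∈ K) ≤ e^{−N(J̃(m)−ε)}` eventually — by the first-order optimality of `m` (the gradient of `J̃` is the log-tilt,
  `hasDerivAt_jointRate_eosY_dir`) the set `K` lies in the half-plane of the tilt of `m`, and the half-plane Chernoff bound
  (`sum_halfPlane_mul_exp_le`) has exactly the rate `J̃(m)`.
* §4 (ed.2) ★★★ THE LIMIT on bounded open convex sets with closure in `T`: `lim (1/N) log P_N(G) = −min_{cl G} J̃` (`ldp_limit_open_convex`).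
Together: the weak large deviation principle for `(bc/N, tc/N)` on convex sets, with the good rate function `J̃`.

## Sources
DemboZeitouni2010 §2.2 (Cramér in ℝ^d: Theorem 2.2.30, the half-space upper bound and the local lower bound) and §1.2 (weak LDP);
JansevanRensburg2000 §3.2 (1st ed., OUP 2000 = the held text; one-density case); BeatonBousquetMelouDeGierDuminilCopinGuttmann2014 §3.2
Proposition 6 (arXiv v5 p. 10; objects).  Nothing quoted AS PRINTED; statements are this lineage's.
-/

noncomputable section

open Filter Topology Finset Literature.Probability.LatticeModels Literature.Probability.Percolation SimpleGraph

namespace Literature.Probability.RandomPlanarGeometry.SAW.HexBW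

open WidthOneYZ

variable {y z : ℝ}

/-! ## §1 Continuity of the rate in density coordinates -/

/-- The joint rate is jointly continuous in the tilt `(Y,Z)` on `(0,∞)²`. [cite: DemboZeitouni2010, §2.2 (lane plumbing)] -/
theorem continuousAt_jointRate₂ (hy : 0 < y) (hz : 0 < z) {Y Z : ℝ} (hY : 0 < Y) (hZ : 0 < Z) :
    ContinuousAt (fun p : ℝ × ℝ => jointRate y z p.1 p.2) (Y, Z) := by
  unfold jointRate
  have hb := continuousAt_contactB₂ hY hZ
  have hb' : ContinuousAt (fun p : ℝ × ℝ => contactB p.2 p.1) (Y, Z) := by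
    have h := continuousAt_contactB₂ hZ hY
    exact ContinuousAt.comp (f := fun p : ℝ × ℝ => (p.2, p.1)) (g := fun p : ℝ × ℝ => contactB p.1 p.2) h
      (continuousAt_snd.prodMk continuousAt_fst)
  have hμ : ContinuousAt (fun p : ℝ × ℝ => stripMuY₂ 1 p.1 p.2) (Y, Z) :=
    (continuousOn_stripMuY₂ 1).continuousAt ((isOpen_Ioi.prod isOpen_Ioi).mem_nhds ⟨hY, hZ⟩)
  have h1 : ContinuousAt (fun p : ℝ × ℝ => Real.log (p.1 / y)) (Y, Z) := (continuousAt_fst.div_const y).log (div_pos hY hy).ne'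
  have h2 : ContinuousAt (fun p : ℝ × ℝ => Real.log (p.2 / z)) (Y, Z) := (continuousAt_snd.div_const z).log (div_pos hZ hz).ne'
  have h3 : ContinuousAt (fun p : ℝ × ℝ => Real.log (stripMuY₂ 1 p.1 p.2 / stripMuY₂ 1 y z)) (Y, Z) :=
    (hμ.div_const _).log (div_pos (stripMuY₂_pos 1 hY hZ) (stripMuY₂_pos 1 hy hz)).ne'
  exact ((hb.mul h1).add (hb'.mul h2)).sub h3

/-- ★ `J̃_{y,z}(a,a') = J(y,z; Y(a,a'), Y(a',a))` is continuous at every point of the open density triangle.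
[cite: DemboZeitouni2010, §2.2 (lane plumbing)] -/
theorem continuousAt_jointRate_eosY (hy : 0 < y) (hz : 0 < z) {a a' : ℝ} (h1 : a + a' < 1 / 2) (h2 : 1 < 4 * a + 2 * a')
    (h3 : 1 < 2 * a + 4 * a') :
    ContinuousAt (fun p : ℝ × ℝ => jointRate y z (eosY p.1 p.2) (eosY p.2 p.1)) (a, a') := by
  obtain ⟨hY0, hZ0, -, -, -, -⟩ := contactB_eosY h1 h2 h3
  have ha : 0 < a := by linarith
  have ha' : 0 < a' := by linarith
  have hE := continuousAt_eosY ha h1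
  have hE' : ContinuousAt (fun p : ℝ × ℝ => eosY p.2 p.1) (a, a') := by
    have h := continuousAt_eosY ha' (by linarith : a' + a < 1 / 2)
    exact ContinuousAt.comp (f := fun p : ℝ × ℝ => (p.2, p.1)) (g := fun p : ℝ × ℝ => eosY p.1 p.2) h
      (continuousAt_snd.prodMk continuousAt_fst)
  have hJ := continuousAt_jointRate₂ hy hz hY0 hZ0
  have h0 : (fun p : ℝ × ℝ => (eosY p.1 p.2, eosY p.2 p.1)) (a, a') = (eosY a a', eosY a' a) := rfl
  rw [← h0] at hJ
  exact ContinuousAt.comp (f := fun p : ℝ × ℝ => (eosY p.1 p.2, eosY p.2 p.1)) (g := fun p : ℝ × ℝ => jointRate y z p.1 p.2)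
    hJ (hE.prodMk hE')

/-! ## §2 The lower bound on open sets -/

open Classical in
/-- ★★★ **LDP LOWER BOUND ON OPEN SETS**: for `y, z > 0`, an open `G ⊆ ℝ²` and a point `p = (a,a') ∈ G` of the open density triangle,
for every `ε > 0` eventually `P_{N,y,z}((bc/N, tc/N) ∈ G) ≥ exp(−N·(J̃_{y,z}(a,a') + ε))` — hence
`liminf (1/N) log P_N(G) ≥ −inf_{G ∩ T} J̃`.  (A box around `p` inside `G`, the two-density tilt of `p`, `exp_le_boxFraction`.)
[cite: DemboZeitouni2010, §2.2 Theorem 2.2.30 (lower bound, local version) and §1.2; JansevanRensburg2000, §3.2 Theorem 3.19 (1st ed., p. 52)] -/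
theorem ldp_lower_open (hy : 0 < y) (hz : 0 < z) {G : Set (ℝ × ℝ)} (hG : IsOpen G) {a a' : ℝ} (hp : (a, a') ∈ G)
    (h1 : a + a' < 1 / 2) (h2 : 1 < 4 * a + 2 * a') (h3 : 1 < 2 * a + 4 * a') {ε : ℝ} (hε : 0 < ε) :
    ∀ᶠ N : ℕ in atTop,
      Real.exp ((-(jointRate y z (eosY a a') (eosY a' a)) - ε) * N) ≤
        (∑ q ∈ (stripPairs 1 N).filter (fun q =>
          (((bottomVisits₀ q.1 q.2 N : ℝ) / N, (topVisits₀ 1 q.1 q.2 N : ℝ) / N) : ℝ × ℝ) ∈ G), wgt y z N q) / stripZ₂ 1 N y z := by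
  obtain ⟨hY0, hZ0, hb, hb', -, -⟩ := contactB_eosY h1 h2 h3
  set Y := eosY a a' with hYd
  set Z := eosY a' a with hZd
  -- a box around `p` inside `G`
  obtain ⟨r, hr0, hball⟩ := Metric.isOpen_iff.1 hG (a, a') hp
  set L := |Real.log (Y / y)| + |Real.log (Z / z)| + 1 with hL
  have hL0 : 0 < L := by positivity
  set η := min (r / 2) (ε / (2 * L)) with hη
  have hη0 : 0 < η := lt_min (by linarith) (by positivity)
  have hηr : η < r := lt_of_le_of_lt (min_le_left _ _) (by linarith)
  have hηε : η ≤ ε / (2 * L) := min_le_right _ _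
  have hbox : ∀ x x' : ℝ, a - η ≤ x → x ≤ a + η → a' - η ≤ x' → x' ≤ a' + η → ((x, x') : ℝ × ℝ) ∈ G := by
    intro x x' k1 k2 k3 k4
    apply hball
    rw [Metric.mem_ball, Prod.dist_eq, Real.dist_eq, Real.dist_eq]
    refine max_lt ?_ ?_
    · rw [abs_lt]; constructor <;> linarith
    · rw [abs_lt]; constructor <;> linarith
  have hq1 : a - η < contactB Y Z := by rw [hb]; linarith
  have hq2 : contactB Y Z < a + η := by rw [hb]; linarith
  have hq1' : a' - η < contactB Z Y := by rw [hb']; linarith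
  have hq2' : contactB Z Y < a' + η := by rw [hb']; linarith
  have hε2 : 0 < ε / 2 := by linarith
  -- the η-box cost is at most `J̃(p) + η(|ℓ|+|ℓ'|) ≤ J̃(p) + ε/2`
  have hmax1 : max ((a - η) * Real.log (Y / y)) ((a + η) * Real.log (Y / y)) ≤ a * Real.log (Y / y) + η * |Real.log (Y / y)| := by
    have k1 := mul_le_mul_of_nonneg_left (neg_le_abs (Real.log (Y / y))) hη0.le
    have k2 := mul_le_mul_of_nonneg_left (le_abs_self (Real.log (Y / y))) hη0.le
    exact max_le (by linarith) (by linarith)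
  have hmax2 : max ((a' - η) * Real.log (Z / z)) ((a' + η) * Real.log (Z / z)) ≤ a' * Real.log (Z / z) + η * |Real.log (Z / z)| := by
    have k1 := mul_le_mul_of_nonneg_left (neg_le_abs (Real.log (Z / z))) hη0.le
    have k2 := mul_le_mul_of_nonneg_left (le_abs_self (Real.log (Z / z))) hη0.le
    exact max_le (by linarith) (by linarith)
  have hextra : η * |Real.log (Y / y)| + η * |Real.log (Z / z)| ≤ ε / 2 := by
    have k1 : η * (|Real.log (Y / y)| + |Real.log (Z / z)|) ≤ η * L := mul_le_mul_of_nonneg_left (by rw [hL]; linarith) hη0.le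
    have k2 : η * L ≤ ε / (2 * L) * L := mul_le_mul_of_nonneg_right hηε hL0.le
    have k3 : ε / (2 * L) * L = ε / 2 := by field_simp
    have k4 : η * (|Real.log (Y / y)| + |Real.log (Z / z)|) = η * |Real.log (Y / y)| + η * |Real.log (Z / z)| := by ring
    linarith
  have hJ : jointRate y z Y Z = a * Real.log (Y / y) + a' * Real.log (Z / z) - Real.log (stripMuY₂ 1 Y Z / stripMuY₂ 1 y z) := by
    unfold jointRate; rw [hb, hb']
  filter_upwards [exp_le_boxFraction hy hz hY0 hZ0 hq1 hq2 hq1' hq2' hε2, Filter.eventually_gt_atTop 0] with N hN hN0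
  have hNr : (0 : ℝ) < N := by exact_mod_cast hN0
  refine le_trans ?_ (hN.trans ?_)
  · refine Real.exp_le_exp.2 (mul_le_mul_of_nonneg_right ?_ (Nat.cast_nonneg N))
    rw [hJ]; linarith [hmax1, hmax2, hextra]
  · refine div_le_div_of_nonneg_right ?_ (stripZ₂_pos 1 N hy hz).le
    refine Finset.sum_le_sum_of_subset_of_nonneg (fun q hq => ?_) fun q _ _ => wgt_nonneg hy.le hz.le N q
    rw [Finset.mem_filter] at hq ⊢
    obtain ⟨hq0, ⟨k1, k2⟩, ⟨k3, k4⟩⟩ := hq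
    refine ⟨hq0, hbox _ _ ?_ ?_ ?_ ?_⟩
    · rw [le_div_iff₀ hNr]; linarith
    · rw [div_le_iff₀ hNr]; linarith
    · rw [le_div_iff₀ hNr]; linarith
    · rw [div_le_iff₀ hNr]; linarith

/-! ## §3 The upper bound on compact convex sets -/

/-- ★★ **First-order optimality**: if `m = (m₁,m₂) ∈ K` minimises `J̃_{y,z}` over a convex `K ⊆ T`, then for every `x ∈ K`,
`log(Y(m)/y)·(x₁ − m₁) + log(Y'(m)/z)·(x₂ − m₂) ≥ 0` — `K` lies in the closed half-plane through `m` normal to the log-tilt of `m`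
(the derivative of `J̃` along the segment `[m, x] ⊆ K` at `m`, `hasDerivAt_jointRate_eosY_dir`, cannot be negative).
[cite: DemboZeitouni2010, §2.2 Theorem 2.2.30 (the half-space containing the set)] -/
theorem halfPlane_of_isMinOn (hy : 0 < y) (hz : 0 < z) {K : Set (ℝ × ℝ)} (hKc : Convex ℝ K)
    (hKT : K ⊆ {p : ℝ × ℝ | p.1 + p.2 < 1 / 2 ∧ 1 < 4 * p.1 + 2 * p.2 ∧ 1 < 2 * p.1 + 4 * p.2}) {m : ℝ × ℝ} (hm : m ∈ K)
    (hmin : IsMinOn (fun p : ℝ × ℝ => jointRate y z (eosY p.1 p.2) (eosY p.2 p.1)) K m) {x : ℝ × ℝ} (hx : x ∈ K) :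
    0 ≤ Real.log (eosY m.1 m.2 / y) * (x.1 - m.1) + Real.log (eosY m.2 m.1 / z) * (x.2 - m.2) := by
  obtain ⟨t1, t2, t3⟩ := hKT hm
  set D := (x.1 - m.1) * Real.log (eosY m.1 m.2 / y) + (x.2 - m.2) * Real.log (eosY m.2 m.1 / z) with hD
  have hder := hasDerivAt_jointRate_eosY_dir hy hz t1 t2 t3 (x.1 - m.1) (x.2 - m.2)
  -- the segment stays in `K`
  have hseg : ∀ θ : ℝ, 0 ≤ θ → θ ≤ 1 → ((m.1 + θ * (x.1 - m.1), m.2 + θ * (x.2 - m.2)) : ℝ × ℝ) ∈ K := by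
    intro θ h0 h1
    have h := hKc.add_smul_sub_mem hm hx ⟨h0, h1⟩
    have e : m + θ • (x - m) = (m.1 + θ * (x.1 - m.1), m.2 + θ * (x.2 - m.2)) := by
      ext <;> simp [smul_eq_mul]
    rw [e] at h; exact h
  by_contra hneg
  push Not at hneg
  have hDneg : D < 0 := by rw [hD]; linarith
  -- slope → D < 0, so for some small θ ∈ (0,1) the value drops below the minimum
  rw [hasDerivAt_iff_tendsto_slope_zero] at hder
  have hev : ∀ᶠ θ : ℝ in 𝓝[≠] 0, θ⁻¹ • (jointRate y z (eosY (m.1 + (0 + θ) * (x.1 - m.1)) (m.2 + (0 + θ) * (x.2 - m.2)))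
      (eosY (m.2 + (0 + θ) * (x.2 - m.2)) (m.1 + (0 + θ) * (x.1 - m.1))) -
      jointRate y z (eosY (m.1 + 0 * (x.1 - m.1)) (m.2 + 0 * (x.2 - m.2))) (eosY (m.2 + 0 * (x.2 - m.2)) (m.1 + 0 * (x.1 - m.1)))) < 0 := by
    have hlim : (x.1 - m.1) * Real.log (eosY m.1 m.2 / y) + (x.2 - m.2) * Real.log (eosY m.2 m.1 / z) < 0 := by rw [← hD]; exact hDneg
    exact hder (gt_mem_nhds hlim)
  have hpos : ∀ᶠ θ : ℝ in 𝓝[≠] (0 : ℝ), θ ∈ Set.Ioo (-1 : ℝ) 1 :=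
    mem_nhdsWithin_of_mem_nhds (Ioo_mem_nhds (by norm_num) (by norm_num))
  -- restrict to positive θ
  have hev' := (hev.and hpos).filter_mono (nhdsWithin_mono _ (show Set.Ioi (0 : ℝ) ⊆ {0}ᶜ from fun t ht => ne_of_gt ht))
  obtain ⟨θ, ⟨hθ, hθ1⟩, hθ0⟩ := (hev'.and self_mem_nhdsWithin).exists
  have hθ0 : 0 < θ := hθ0
  simp only [zero_add, zero_mul, add_zero, smul_eq_mul] at hθ
  have hlt : jointRate y z (eosY (m.1 + θ * (x.1 - m.1)) (m.2 + θ * (x.2 - m.2)))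
      (eosY (m.2 + θ * (x.2 - m.2)) (m.1 + θ * (x.1 - m.1))) < jointRate y z (eosY m.1 m.2) (eosY m.2 m.1) := by
    have := (mul_neg_iff.1 hθ)
    rcases this with ⟨hinv, hd⟩ | ⟨hinv, hd⟩
    · linarith
    · exfalso; exact absurd (inv_pos.2 hθ0) (not_lt.2 hinv.le)
  have hmem := hseg θ hθ0.le hθ1.2.le
  have hge := (isMinOn_iff.1 hmin) _ hmem
  simp only at hge
  linarith

open Classical in
/-- ★★★ **LDP UPPER BOUND ON COMPACT CONVEX SETS**: for `y, z > 0` and a nonempty compact convex `K` inside the open density triangle,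
there is a minimiser `m ∈ K` of `J̃_{y,z}` on `K`, and for every `ε > 0` eventually
`P_{N,y,z}((bc/N, tc/N) ∈ K) ≤ exp(N·(−J̃_{y,z}(m) + ε))` — hence `limsup (1/N) log P_N(K) ≤ −min_K J̃`.
Proof: `K` lies in the half-plane of the log-tilt of `m` (`halfPlane_of_isMinOn`), whose Chernoff bound (`sum_halfPlane_mul_exp_le` with the
tilt `(Y(m), Y'(m)) = (y e^{ℓ}, z e^{ℓ'})`) has rate exactly `J̃(m)`.  With §2 this is the weak LDP on convex sets.
[cite: DemboZeitouni2010, §2.2 Theorem 2.2.30 (upper bound for compact convex sets via one half-space) and Exercise 2.2.38; JansevanRensburg2000, §3.2 Theorems 3.17–3.19 (1st ed., pp. 50–52)] -/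
theorem ldp_upper_compact_convex (hy : 0 < y) (hz : 0 < z) {K : Set (ℝ × ℝ)} (hK : IsCompact K) (hKc : Convex ℝ K)
    (hne : K.Nonempty) (hKT : K ⊆ {p : ℝ × ℝ | p.1 + p.2 < 1 / 2 ∧ 1 < 4 * p.1 + 2 * p.2 ∧ 1 < 2 * p.1 + 4 * p.2}) :
    ∃ m ∈ K, IsMinOn (fun p : ℝ × ℝ => jointRate y z (eosY p.1 p.2) (eosY p.2 p.1)) K m ∧
      ∀ {ε : ℝ}, 0 < ε → ∀ᶠ N : ℕ in atTop,
        (∑ q ∈ (stripPairs 1 N).filter (fun q =>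
          (((bottomVisits₀ q.1 q.2 N : ℝ) / N, (topVisits₀ 1 q.1 q.2 N : ℝ) / N) : ℝ × ℝ) ∈ K), wgt y z N q) / stripZ₂ 1 N y z ≤
        Real.exp ((-(jointRate y z (eosY m.1 m.2) (eosY m.2 m.1)) + ε) * N) := by
  -- existence of the minimiser
  have hcont : ContinuousOn (fun p : ℝ × ℝ => jointRate y z (eosY p.1 p.2) (eosY p.2 p.1)) K := by
    intro p hp
    obtain ⟨t1, t2, t3⟩ := hKT hp
    exact (continuousAt_jointRate_eosY hy hz t1 t2 t3).continuousWithinAt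
  obtain ⟨m, hm, hmin⟩ := hK.exists_isMinOn hne hcont
  refine ⟨m, hm, hmin, fun {ε} hε => ?_⟩
  obtain ⟨t1, t2, t3⟩ := hKT hm
  obtain ⟨hY0, hZ0, hb, hb', -, -⟩ := contactB_eosY t1 t2 t3
  set Y := eosY m.1 m.2 with hYd
  set Z := eosY m.2 m.1 with hZd
  set u := Real.log (Y / y) with hu
  set v := Real.log (Z / z) with hv
  have eY : y * Real.exp (1 * u) = Y := by rw [one_mul, hu, Real.exp_log (div_pos hY0 hy)]; field_simp
  have eZ : z * Real.exp (1 * v) = Z := by rw [one_mul, hv, Real.exp_log (div_pos hZ0 hz)]; field_simp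
  set c := u * m.1 + v * m.2 with hc
  -- the half-plane Chernoff bound at the tilt of `m`
  have hS := fun N : ℕ => sum_halfPlane_mul_exp_le hy.le hz.le u v (zero_le_one) c N
  simp only [eY, eZ] at hS
  have hch := fraction_le_exp_of_chernoff₂ hy hz hY0 hZ0 (Real.exp_pos (1 * c)) 1 0 _ hS hε
  filter_upwards [hch, Filter.eventually_gt_atTop 0] with N hN hN0
  have hNr : (0 : ℝ) < N := by exact_mod_cast hN0
  have e : -jointRate y z Y Z + ε = -((1 : ℝ) * Real.log (Real.exp (1 * c)) - Real.log (stripMuY₂ 1 Y Z / stripMuY₂ 1 y z)) + ε := by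
    rw [Real.log_exp]; unfold jointRate; rw [hb, hb', hc, hu, hv]; ring
  rw [e]
  refine le_trans ?_ hN
  refine div_le_div_of_nonneg_right ?_ (stripZ₂_pos 1 N hy hz).le
  refine Finset.sum_le_sum_of_subset_of_nonneg (fun q hq => ?_) fun q _ _ => wgt_nonneg hy.le hz.le N q
  rw [Finset.mem_filter] at hq ⊢
  refine ⟨hq.1, ?_⟩
  have key := halfPlane_of_isMinOn hy hz hKc hKT hm hmin hq.2
  simp only at key
  -- `u (x₁ − m₁) + v (x₂ − m₂) ≥ 0` with `x = (bc/N, tc/N)` gives `cN ≤ u·bc + v·tc`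
  have k2 : c ≤ u * ((bottomVisits₀ q.1 q.2 N : ℝ) / N) + v * ((topVisits₀ 1 q.1 q.2 N : ℝ) / N) := by rw [hc]; linarith
  have k3 : c * N ≤ (u * ((bottomVisits₀ q.1 q.2 N : ℝ) / N) + v * ((topVisits₀ 1 q.1 q.2 N : ℝ) / N)) * N :=
    mul_le_mul_of_nonneg_right k2 hNr.le
  have e2 : (u * ((bottomVisits₀ q.1 q.2 N : ℝ) / N) + v * ((topVisits₀ 1 q.1 q.2 N : ℝ) / N)) * N =
      u * (bottomVisits₀ q.1 q.2 N : ℝ) + v * (topVisits₀ 1 q.1 q.2 N : ℝ) := by field_simp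
  linarith

/-! ## §4 (ed.2) The full limit on bounded open convex sets -/

open Classical in
/-- ★★★ **THE LARGE DEVIATION LIMIT ON BOUNDED OPEN CONVEX SETS**: for `y, z > 0` and a nonempty bounded open convex `G` whose closure
lies in the open density triangle, there is a minimiser `m ∈ closure G` of `J̃_{y,z}` with
`lim_{N→∞} (1/N) log P_{N,y,z}((bc/N, tc/N) ∈ G) = −J̃_{y,z}(m) = −inf_G J̃_{y,z}`
(upper bound on the compact convex closure, §3; lower bound at points of `G` near `m`, §2 and the continuity of `J̃`).
[cite: DemboZeitouni2010, §2.2 Theorem 2.2.30 and §1.2 (weak LDP; `J̃`-continuity sets); JansevanRensburg2000, §3.2 Theorems 3.17–3.19 (1st ed., pp. 50–52)] -/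
theorem ldp_limit_open_convex (hy : 0 < y) (hz : 0 < z) {G : Set (ℝ × ℝ)} (hGo : IsOpen G) (hGc : Convex ℝ G)
    (hne : G.Nonempty) (hbd : Bornology.IsBounded G)
    (hGT : closure G ⊆ {p : ℝ × ℝ | p.1 + p.2 < 1 / 2 ∧ 1 < 4 * p.1 + 2 * p.2 ∧ 1 < 2 * p.1 + 4 * p.2}) :
    ∃ m ∈ closure G, IsMinOn (fun p : ℝ × ℝ => jointRate y z (eosY p.1 p.2) (eosY p.2 p.1)) (closure G) m ∧
      Tendsto (fun N : ℕ => Real.log ((∑ q ∈ (stripPairs 1 N).filter (fun q =>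
          (((bottomVisits₀ q.1 q.2 N : ℝ) / N, (topVisits₀ 1 q.1 q.2 N : ℝ) / N) : ℝ × ℝ) ∈ G), wgt y z N q) / stripZ₂ 1 N y z) / N)
        atTop (𝓝 (-(jointRate y z (eosY m.1 m.2) (eosY m.2 m.1)))) := by
  have hK : IsCompact (closure G) := hbd.isCompact_closure
  have hKc : Convex ℝ (closure G) := hGc.closure
  have hKne : (closure G).Nonempty := hne.mono subset_closure
  obtain ⟨m, hm, hmin, hup⟩ := ldp_upper_compact_convex hy hz hK hKc hKne hGT
  refine ⟨m, hm, hmin, ?_⟩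
  obtain ⟨t1, t2, t3⟩ := hGT hm
  set J := jointRate y z (eosY m.1 m.2) (eosY m.2 m.1) with hJ
  refine tendsto_log_div_of_exp_bounds (fun ε hε => ?_) (fun ε hε => ?_)
  · -- lower bound: a point of `G` near `m` with `J̃ < J̃(m) + ε/2`
    have hε2 : 0 < ε / 2 := by linarith
    have hcont := continuousAt_jointRate_eosY hy hz t1 t2 t3
    have hlt : (fun p : ℝ × ℝ => jointRate y z (eosY p.1 p.2) (eosY p.2 p.1)) m < J + ε / 2 := by
      simp only [hJ]; linarith
    have hev := hcont.eventually (gt_mem_nhds hlt)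
    obtain ⟨U, hU, hUo, hmU⟩ := mem_nhds_iff.1 hev
    obtain ⟨p, hpU, hpG⟩ : (U ∩ G).Nonempty := mem_closure_iff.1 hm U hUo hmU
    have hpJ : jointRate y z (eosY p.1 p.2) (eosY p.2 p.1) < J + ε / 2 := hU hpU
    obtain ⟨s1, s2, s3⟩ := hGT (subset_closure hpG)
    have hpG' : (p.1, p.2) ∈ G := hpG
    filter_upwards [ldp_lower_open hy hz hGo hpG' s1 s2 s3 hε2] with N hN
    refine le_trans (Real.exp_le_exp.2 (mul_le_mul_of_nonneg_right ?_ (Nat.cast_nonneg N))) hN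
    linarith
  · -- upper bound: `G ⊆ closure G`
    filter_upwards [hup hε] with N hN
    refine le_trans ?_ hN
    refine div_le_div_of_nonneg_right ?_ (stripZ₂_pos 1 N hy hz).le
    refine Finset.sum_le_sum_of_subset_of_nonneg (fun q hq => ?_) fun q _ _ => wgt_nonneg hy.le hz.le N q
    rw [Finset.mem_filter] at hq ⊢
    exact ⟨hq.1, subset_closure hq.2⟩

end Literature.Probability.RandomPlanarGeometry.SAW.HexBW
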